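import Literature.AlgebraicGeometry.Frobenioids.PerfectionCoAngular
import Mathlib.CategoryTheory.Equivalence
import HarnessLib

/-!
# Frobenioids I, Theorem 3.4 (iii), the perfection square: functoriality of `C ↦ C^pf` along functors
# compatible with arrows of Frobenius type (CONSTRUCTION + PROOFS)

Mochizuki, *The geometry of Frobenioids I: the general theory*, Kyushu J. Math. **62** (2008),
Definition 3.1 (ii), (iii) pp. 56–57, Theorem 3.4 (iii) p. 62 [cite: MochizukiFrdI2008, Thm. 3.4 (iii) p.62]:
"… `Ψ` induces a `1`-unique functor `Ψ^pf : C₁^pf → C₂^pf` that fits into a `1`-commutative diagram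
[with `C_i → C_i^pf`]". This file constructs `Ψ^pf` and the square for THE perfections of abc-iut-L1-d9's chain
(`Perfection hF_i`, `Perfection.toPf hF_i`), from the only two properties of `Ψ` the construction uses —
`Ψ` carries arrows of Frobenius type to arrows of Frobenius type, of the same Frobenius degree (the content of
Thm. 3.4 (iii), seat abc-iut-L1-t13, which instantiates the present file; abc-iut cell PIECES protocol):

* `IsFrobeniusCompatible F₁ F₂ G` — the two hypotheses on `G : C₁ ⥤ C₂`;
* `frobPowIso` — `G(A^{(a)}) ≅ (G A)^{(a)}` under `G A` (essential uniqueness, Def. 1.3 (ii)), and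
  `map_frobTrans` — `G` carries the transition morphisms to the transition morphisms;
* `objMap`, `levelMap`, `repMap`, `repMap_lift` — `(A, n) ↦ (G A, n)`, representatives `θ ↦ G θ` conjugated
  by the `frobPowIso`'s, compatibly with transport;
* `map G hG : Perfection hF₁ ⥤ Perfection hF₂` — the functor `Ψ^pf`;
* `map_toPf_map`, `toPfCompMapIso` — the square `(C₁ → C₁^pf) ⋙ Ψ^pf ≅ Ψ ⋙ (C₂ → C₂^pf)` (it commutes on
  objects on the nose and on arrows by `conjFr_unique`);
* `rootIso` — an isomorphism `A ≅ B` of `C` induces `(A, n) ≅ (B, n)`;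
* for an equivalence `Ψ` whose functor is Frobenius-compatible: `map_faithful`, `map_full`, `map_essSurj`,
  `map_isEquivalence` — `Ψ^pf` is an equivalence.
The `1`-uniqueness and rigidity conjuncts of the typed `Thm34iii_pf` are not treated here.
-/

namespace Literature.AlgebraicGeometry.Frobenioids

namespace PreFrobenioid

open CategoryTheory Opposite

universe w₁ v₁ v₁' u₁ u₁' w₂ v₂ v₂' u₂ u₂'

variable {D₁ : Type u₁} [Category.{v₁} D₁] {Φ₁ : D₁ᵒᵖ ⥤ CommMonCat.{w₁}}
  {C₁ : Type u₁'} [Category.{v₁'} C₁] {F₁ : C₁ ⥤ ElemFrobenioid Φ₁} {hF₁ : IsFrobenioid F₁}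
  {D₂ : Type u₂} [Category.{v₂} D₂] {Φ₂ : D₂ᵒᵖ ⥤ CommMonCat.{w₂}}
  {C₂ : Type u₂'} [Category.{v₂'} C₂] {F₂ : C₂ ⥤ ElemFrobenioid Φ₂} {hF₂ : IsFrobenioid F₂}

variable (F₁ F₂) in
/-- The two properties of a functor `G : C₁ → C₂` between (the underlying categories of) Frobenioids used to
define `G^pf : C₁^pf → C₂^pf`: `G` carries arrows of Frobenius type to arrows of Frobenius type, preserving
their Frobenius degrees (for an equivalence between Frobenioids of standard type these are assertions of
Thm. 3.4 (iii)). [cite: MochizukiFrdI2008, Thm. 3.4 (iii) p.62] -/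
structure IsFrobeniusCompatible (G : C₁ ⥤ C₂) : Prop where
  /-- arrows of Frobenius type go to arrows of Frobenius type -/
  isFrobeniusType_map : ∀ ⦃A B : C₁⦄ (f : A ⟶ B), IsFrobeniusType F₁ f → IsFrobeniusType F₂ (G.map f)
  /-- … of the same Frobenius degree -/
  degFr_map : ∀ ⦃A B : C₁⦄ (f : A ⟶ B), IsFrobeniusType F₁ f → degFr F₂ (G.map f) = degFr F₁ f

namespace Perfection

/-! ### Objects and levels -/

/-- `(A, n) ↦ (G A, n)`. [cite: MochizukiFrdI2008, Thm. 3.4 (iii) p.62] -/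
abbrev objMap (G : C₁ ⥤ C₂) (X : Perfection hF₁) : Perfection hF₂ := ⟨G.obj X.obj, X.idx⟩

/-- A level of `(A, n) → (B, m)` is a level of `(G A, n) → (G B, m)` (same indices).
[cite: MochizukiFrdI2008, Def. 3.1 (ii) p.56] -/
abbrev levelMap (G : C₁ ⥤ C₂) {X Y : Perfection hF₁} (L : Level X Y) :
    Level (objMap (hF₂ := hF₂) G X) (objMap (hF₂ := hF₂) G Y) :=
  ⟨L.a, L.b, L.eq⟩

/-- The order on levels is unchanged. [cite: MochizukiFrdI2008, Def. 3.1 (ii) p.56] -/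
theorem levelMap_le (G : C₁ ⥤ C₂) {X Y : Perfection hF₁} {L L' : Level X Y} (h : L.LE L') :
    (levelMap (hF₂ := hF₂) G L).LE (levelMap (hF₂ := hF₂) G L') :=
  h

section Compatible

variable {G : C₁ ⥤ C₂} (hG : IsFrobeniusCompatible F₁ F₂ G)
include hG

/-! ### `G` on the chosen Frobenius powers -/

/-- The comparison `G(A^{(a)}) ≅ (G A)^{(a)}` under `G A`: both `G(A → A^{(a)})` and `G A → (G A)^{(a)}` are of
Frobenius type of degree `a` out of `G A` (Def. 1.3 (ii), essential uniqueness).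
[cite: MochizukiFrdI2008, Def. 1.3 (ii) p.24] -/
theorem exists_frobPowIso (A : C₁) (a : ℕ+) :
    ∃ j : G.obj (frobPow hF₁ A a) ≅ frobPow hF₂ (G.obj A) a, G.map (frob hF₁ A a) ≫ j.hom = frob hF₂ (G.obj A) a :=
  hF₂.ii_unique _ _ (hG.isFrobeniusType_map _ (isFrobeniusType_frob hF₁ A a)) (isFrobeniusType_frob hF₂ _ a)
    (by rw [hG.degFr_map _ (isFrobeniusType_frob hF₁ A a), degFr_frob, degFr_frob])

/-- A chosen comparison isomorphism `G(A^{(a)}) ≅ (G A)^{(a)}` under `G A`. [cite: MochizukiFrdI2008, Def. 1.3 (ii) p.24] -/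
noncomputable def frobPowIso (A : C₁) (a : ℕ+) : G.obj (frobPow hF₁ A a) ≅ frobPow hF₂ (G.obj A) a :=
  (exists_frobPowIso (hF₁ := hF₁) (hF₂ := hF₂) hG A a).choose

/-- `G(frob_A) ≫ j = frob_{GA}`. [cite: MochizukiFrdI2008, Def. 1.3 (ii) p.24] -/
theorem map_frob_frobPowIso (A : C₁) (a : ℕ+) :
    G.map (frob hF₁ A a) ≫ (frobPowIso (hF₁ := hF₁) (hF₂ := hF₂) hG A a).hom = frob hF₂ (G.obj A) a :=
  (exists_frobPowIso (hF₁ := hF₁) (hF₂ := hF₂) hG A a).choose_spec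

/-- `G` carries transition morphisms to transition morphisms (after the comparison isomorphisms): both sides
are the unique arrow under `G A` from `(G A)^{(a)}` to `(G A)^{(a′)}`. [cite: MochizukiFrdI2008, Def. 3.1 (ii) p.56] -/
theorem map_frobTrans (A : C₁) {a a' : ℕ+} (h : a ∣ a') :
    (frobPowIso (hF₁ := hF₁) (hF₂ := hF₂) hG A a).inv ≫ G.map (frobTrans hF₁ A h) ≫
        (frobPowIso (hF₁ := hF₁) (hF₂ := hF₂) hG A a').hom = frobTrans hF₂ (G.obj A) h := by
  apply frobTrans_unique hF₂ (G.obj A) h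
  rw [← map_frob_frobPowIso (hF₁ := hF₁) (hF₂ := hF₂) hG A a, Category.assoc, Iso.hom_inv_id_assoc,
    ← Category.assoc, ← G.map_comp, frob_frobTrans hF₁ A h, map_frob_frobPowIso (hF₁ := hF₁) (hF₂ := hF₂) hG A a']

/-! ### `G` on representatives -/

/-- `G` on a representative `θ : A^{(a)} → B^{(b)}`: `j_A⁻¹ ≫ G θ ≫ j_B : (G A)^{(a)} → (G B)^{(b)}` at the same
level. [cite: MochizukiFrdI2008, Thm. 3.4 (iii) p.62] -/
noncomputable def repMap {X Y : Perfection hF₁} (r : Rep X Y) :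
    Rep (objMap (hF₂ := hF₂) G X) (objMap (hF₂ := hF₂) G Y) :=
  ⟨levelMap G r.L, (frobPowIso (hF₁ := hF₁) (hF₂ := hF₂) hG X.obj r.L.a).inv ≫ G.map r.hom ≫
    (frobPowIso (hF₁ := hF₁) (hF₂ := hF₂) hG Y.obj r.L.b).hom⟩

/-- The arrow of `repMap`. [cite: MochizukiFrdI2008, Thm. 3.4 (iii) p.62] -/
theorem repMap_hom {X Y : Perfection hF₁} (r : Rep X Y) :
    (repMap (hF₁ := hF₁) (hF₂ := hF₂) hG r).hom = (frobPowIso (hF₁ := hF₁) (hF₂ := hF₂) hG X.obj r.L.a).inv ≫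
      G.map r.hom ≫ (frobPowIso (hF₁ := hF₁) (hF₂ := hF₂) hG Y.obj r.L.b).hom :=
  rfl

/-- `repMap` commutes with transport: `G` carries the transition squares of `C₁` to those of `C₂`
(`map_frobTrans`), so the transported image is the image of the transport (uniqueness of transports).
[cite: MochizukiFrdI2008, Def. 3.1 (ii) p.56] -/
theorem repMap_lift {X Y : Perfection hF₁} (L L' : Level X Y) (h : L.LE L') (θ : L.HomAt) :
    (repMap (hF₁ := hF₁) (hF₂ := hF₂) hG ⟨L', Level.lift L L' h θ⟩).hom =
      Level.lift (levelMap G L) (levelMap G L') (levelMap_le G h)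
        (repMap (hF₁ := hF₁) (hF₂ := hF₂) hG ⟨L, θ⟩).hom := by
  refine Level.lift_unique _ _ _ ?_
  change frobTrans hF₂ (G.obj X.obj) h.1 ≫ (frobPowIso hG X.obj L'.a).inv ≫ G.map (Level.lift L L' h θ) ≫
      (frobPowIso hG Y.obj L'.b).hom =
    ((frobPowIso hG X.obj L.a).inv ≫ G.map θ ≫ (frobPowIso hG Y.obj L.b).hom) ≫ frobTrans hF₂ (G.obj Y.obj) h.2
  rw [← map_frobTrans hG X.obj h.1, ← map_frobTrans hG Y.obj h.2]
  simp only [Category.assoc, Iso.hom_inv_id_assoc]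
  rw [← G.map_comp_assoc, Level.lift_spec, G.map_comp_assoc]

/-- `repMap` respects agreement of representatives. [cite: MochizukiFrdI2008, Def. 3.1 (ii) p.56] -/
theorem repMap_sound {X Y : Perfection hF₁} {r s : Rep X Y} (h : Agree r s) :
    Agree (repMap (hF₁ := hF₁) (hF₂ := hF₂) hG r) (repMap (hF₁ := hF₁) (hF₂ := hF₂) hG s) := by
  obtain ⟨M, hr, hs, e⟩ := h
  refine ⟨levelMap G M, levelMap_le G hr, levelMap_le G hs, ?_⟩
  have er : (repMap (hF₁ := hF₁) (hF₂ := hF₂) hG ⟨M, Level.lift r.L M hr r.hom⟩).hom =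
      Level.lift (levelMap G r.L) (levelMap G M) (levelMap_le G hr) (repMap (hF₁ := hF₁) (hF₂ := hF₂) hG r).hom :=
    repMap_lift hG r.L M hr r.hom
  have es : (repMap (hF₁ := hF₁) (hF₂ := hF₂) hG ⟨M, Level.lift s.L M hs s.hom⟩).hom =
      Level.lift (levelMap G s.L) (levelMap G M) (levelMap_le G hs) (repMap (hF₁ := hF₁) (hF₂ := hF₂) hG s).hom :=
    repMap_lift hG s.L M hs s.hom
  change Level.lift (levelMap G r.L) (levelMap G M) (levelMap_le G hr) (repMap hG r).hom =
    Level.lift (levelMap G s.L) (levelMap G M) (levelMap_le G hs) (repMap hG s).hom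
  rw [← er, ← es, e]

/-- `G^pf` on perfected morphisms. [cite: MochizukiFrdI2008, Thm. 3.4 (iii) p.62] -/
noncomputable def homMap {X Y : Perfection hF₁} :
    (X ⟶ Y) → (objMap (hF₂ := hF₂) G X ⟶ objMap (hF₂ := hF₂) G Y) :=
  Quotient.lift (fun r => Hom.mk (repMap (hF₁ := hF₁) (hF₂ := hF₂) hG r))
    fun _ _ h => Hom.mk_eq_mk.mpr (repMap_sound hG h)

/-- `G^pf` on the class of a representative. [cite: MochizukiFrdI2008, Thm. 3.4 (iii) p.62] -/
theorem homMap_mk {X Y : Perfection hF₁} (r : Rep X Y) :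
    homMap (hF₁ := hF₁) (hF₂ := hF₂) hG (Hom.mk r) = Hom.mk (repMap (hF₁ := hF₁) (hF₂ := hF₂) hG r) :=
  rfl

/-- `repMap` of an identity representative is an identity representative. [cite: MochizukiFrdI2008, Def. 3.1 (iii) p.57] -/
theorem repMap_id (X : Perfection hF₁) :
    repMap (hF₁ := hF₁) (hF₂ := hF₂) hG (Rep.id X) = Rep.id (objMap (hF₂ := hF₂) G X) := by
  change (⟨⟨1, 1, rfl⟩, (frobPowIso hG X.obj 1).inv ≫ G.map (𝟙 (frobPow hF₁ X.obj 1)) ≫ (frobPowIso hG X.obj 1).hom⟩ :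
      Rep (objMap (hF₂ := hF₂) G X) (objMap (hF₂ := hF₂) G X)) =
    ⟨⟨1, 1, rfl⟩, 𝟙 (frobPow hF₂ (G.obj X.obj) 1)⟩
  rw [G.map_id, Category.id_comp, Iso.inv_hom_id]

/-- `repMap` of a composite computed at a triple level is the composite of the images at the same triple
level. [cite: MochizukiFrdI2008, Def. 3.1 (iii) p.57] -/
theorem repMap_compAt {X Y Z : Perfection hF₁} (T : Level₃ X Y Z) (r : Rep X Y) (s : Rep Y Z)
    (hr : r.L.LE T.fst) (hs : s.L.LE T.snd) :
    (repMap (hF₁ := hF₁) (hF₂ := hF₂) hG ⟨T.out, compAt T r s hr hs⟩).hom =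
      Level.lift (levelMap G r.L) (levelMap G T.fst) (levelMap_le G hr)
          (repMap (hF₁ := hF₁) (hF₂ := hF₂) hG r).hom ≫
        Level.lift (levelMap G s.L) (levelMap G T.snd) (levelMap_le G hs)
          (repMap (hF₁ := hF₁) (hF₂ := hF₂) hG s).hom := by
  have er : (repMap (hF₁ := hF₁) (hF₂ := hF₂) hG ⟨T.fst, Level.lift r.L T.fst hr r.hom⟩).hom =
      Level.lift (levelMap G r.L) (levelMap G T.fst) (levelMap_le G hr) (repMap (hF₁ := hF₁) (hF₂ := hF₂) hG r).hom :=
    repMap_lift hG r.L T.fst hr r.hom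
  have es : (repMap (hF₁ := hF₁) (hF₂ := hF₂) hG ⟨T.snd, Level.lift s.L T.snd hs s.hom⟩).hom =
      Level.lift (levelMap G s.L) (levelMap G T.snd) (levelMap_le G hs) (repMap (hF₁ := hF₁) (hF₂ := hF₂) hG s).hom :=
    repMap_lift hG s.L T.snd hs s.hom
  rw [← er, ← es]
  change (frobPowIso hG X.obj T.a).inv ≫ G.map (Level.lift r.L T.fst hr r.hom ≫ Level.lift s.L T.snd hs s.hom) ≫
      (frobPowIso hG Z.obj T.c).hom =
    ((frobPowIso hG X.obj T.a).inv ≫ G.map (Level.lift r.L T.fst hr r.hom) ≫ (frobPowIso hG Y.obj T.b).hom) ≫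
      (frobPowIso hG Y.obj T.b).inv ≫ G.map (Level.lift s.L T.snd hs s.hom) ≫ (frobPowIso hG Z.obj T.c).hom
  simp only [Category.assoc, Iso.hom_inv_id_assoc, G.map_comp]

/-- **The functor `Ψ^pf : C₁^pf → C₂^pf`** induced by a Frobenius-compatible `Ψ : C₁ → C₂`:
`(A, n) ↦ (Ψ A, n)`, `[θ : A^{(a)} → B^{(b)}] ↦ [j_A⁻¹ ≫ Ψ θ ≫ j_B]`. [cite: MochizukiFrdI2008, Thm. 3.4 (iii) p.62] -/
noncomputable def map : Perfection hF₁ ⥤ Perfection hF₂ where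
  obj := objMap G
  map f := homMap hG f
  map_id X := by
    rw [id_eq_mk, homMap_mk, repMap_id, ← id_eq_mk]
  map_comp {X Y Z} f g := by
    obtain ⟨r, rfl⟩ := Hom.mk_surjective f
    obtain ⟨s, rfl⟩ := Hom.mk_surjective g
    change homMap hG (Hom.mk r ≫ Hom.mk s) =
      (Hom.mk (repMap hG r) ≫ Hom.mk (repMap hG s) : objMap G X ⟶ objMap G Z)
    rw [mk_comp_mk, mk_comp_mk, homMap_mk]
    -- both sides are composites at the canonical triple level (the levels coincide)
    let T : Level₃ X Y Z := Level₃.can r s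
    let T' : Level₃ (objMap (hF₂ := hF₂) G X) (objMap G Y) (objMap G Z) := Level₃.can (repMap hG r) (repMap hG s)
    apply Hom.mk_eq_mk.mpr
    refine ⟨T'.out, Level.le_rfl _, Level.le_rfl _, ?_⟩
    change Level.lift T'.out T'.out (Level.le_rfl _)
        (repMap hG ⟨T.out, compAt T r s (Level₃.le_can_fst r s) (Level₃.le_can_snd r s)⟩).hom =
      Level.lift T'.out T'.out (Level.le_rfl _)
        (compAt T' (repMap hG r) (repMap hG s) (Level₃.le_can_fst _ _) (Level₃.le_can_snd _ _))
    rw [Level.lift_rfl, Level.lift_rfl]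
    exact repMap_compAt hG T r s _ _

/-- `Ψ^pf` on objects. [cite: MochizukiFrdI2008, Thm. 3.4 (iii) p.62] -/
theorem map_obj (X : Perfection hF₁) : (map (hF₁ := hF₁) (hF₂ := hF₂) hG).obj X = ⟨G.obj X.obj, X.idx⟩ := rfl

/-- `Ψ^pf` on the class of a representative. [cite: MochizukiFrdI2008, Thm. 3.4 (iii) p.62] -/
theorem map_mk {X Y : Perfection hF₁} (r : Rep X Y) :
    (map (hF₁ := hF₁) (hF₂ := hF₂) hG).map (Hom.mk r) = Hom.mk (repMap (hF₁ := hF₁) (hF₂ := hF₂) hG r) :=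
  rfl

/-! ### The square `(C₁ → C₁^pf) ⋙ Ψ^pf ≅ Ψ ⋙ (C₂ → C₂^pf)` -/

/-- `Ψ` carries the defining conjugate of `toPf φ` to that of `toPf (Ψ φ)`.
[cite: MochizukiFrdI2008, Thm. 3.4 (iii) p.62] -/
theorem repMap_toPfRep_hom {A B : C₁} (φ : A ⟶ B) :
    (repMap (hF₁ := hF₁) (hF₂ := hF₂) hG (toPfRep hF₁ φ)).hom = (toPfRep hF₂ (G.map φ)).hom :=
  conjFr_unique (hF := hF₂) (isFrobeniusType_frob hF₂ (G.obj A) 1) (isFrobeniusType_frob hF₂ (G.obj B) 1)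
    ((degFr_frob hF₂ (G.obj A) 1).trans (degFr_frob hF₂ (G.obj B) 1).symm) (by
    change frob hF₂ (G.obj A) 1 ≫ (frobPowIso (hF₁ := hF₁) (hF₂ := hF₂) hG A 1).inv ≫ G.map (toPfRep hF₁ φ).hom ≫
        (frobPowIso (hF₁ := hF₁) (hF₂ := hF₂) hG B 1).hom = G.map φ ≫ frob hF₂ (G.obj B) 1
    rw [← map_frob_frobPowIso (hF₁ := hF₁) (hF₂ := hF₂) hG A 1, ← map_frob_frobPowIso (hF₁ := hF₁) (hF₂ := hF₂) hG B 1,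
      Category.assoc, Iso.hom_inv_id_assoc, ← G.map_comp_assoc, frob_toPfRep, G.map_comp_assoc])

/-- `Ψ` carries the defining representative of `toPf φ` to that of `toPf (Ψ φ)`.
[cite: MochizukiFrdI2008, Thm. 3.4 (iii) p.62] -/
theorem repMap_toPfRep {A B : C₁} (φ : A ⟶ B) :
    repMap (hF₁ := hF₁) (hF₂ := hF₂) hG (toPfRep hF₁ φ) = toPfRep hF₂ (G.map φ) :=
  congrArg (Rep.mk (⟨1, 1, rfl⟩ : Level (root hF₂ (G.obj A) 1) (root hF₂ (G.obj B) 1)))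
    (repMap_toPfRep_hom hG φ)

/-- The square commutes on arrows (and on objects on the nose): `Ψ^pf (toPf φ) = toPf (Ψ φ)`.
[cite: MochizukiFrdI2008, Thm. 3.4 (iii) p.62] -/
theorem map_toPf_map {A B : C₁} (φ : A ⟶ B) :
    (map (hF₁ := hF₁) (hF₂ := hF₂) hG).map ((toPf hF₁).map φ) = (toPf hF₂).map (G.map φ) :=
  congrArg Hom.mk (repMap_toPfRep hG φ)

/-- **The `1`-commutative square of Thm. 3.4 (iii)** for THE perfections: `toPf ⋙ Ψ^pf ≅ Ψ ⋙ toPf`, with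
identity components. [cite: MochizukiFrdI2008, Thm. 3.4 (iii) p.62] -/
noncomputable def toPfCompMapIso : toPf hF₁ ⋙ map (hF₁ := hF₁) (hF₂ := hF₂) hG ≅ G ⋙ toPf hF₂ :=
  NatIso.ofComponents (fun _ => Iso.refl _) fun {A B} φ => by
    change (map hG).map ((toPf hF₁).map φ) ≫ 𝟙 _ = 𝟙 _ ≫ (toPf hF₂).map (G.map φ)
    rw [Category.comp_id, Category.id_comp, map_toPf_map]

/-- The square `1`-commutes. [cite: MochizukiFrdI2008, Thm. 3.4 (iii) p.62] -/
theorem oneCommutes_toPf_map : OneCommutes (toPf hF₁) (map (hF₁ := hF₁) (hF₂ := hF₂) hG) G (toPf hF₂) :=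
  ⟨toPfCompMapIso hG⟩

end Compatible

/-! ### Isomorphic roots -/

/-- An isomorphism `ι : A ≅ B` of `C` induces `(A, n) ≅ (B, n)` in `C^pf` (the class at level `(1, 1)` of the
conjugate of `ι`, whose inverse is the conjugate of `ι⁻¹`). [cite: MochizukiFrdI2008, Def. 3.1 (iii) p.57] -/
theorem nonempty_rootIso {A B : C₁} (ι : A ≅ B) (n : ℕ+) : Nonempty ((⟨A, n⟩ : Perfection hF₁) ≅ ⟨B, n⟩) := by
  have hA := isFrobeniusType_frob hF₁ A 1
  have hB := isFrobeniusType_frob hF₁ B 1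
  have hAB : degFr F₁ (frob hF₁ A 1) = degFr F₁ (frob hF₁ B 1) := by rw [degFr_frob, degFr_frob]
  have hBA : degFr F₁ (frob hF₁ B 1) = degFr F₁ (frob hF₁ A 1) := by rw [degFr_frob, degFr_frob]
  have h₁ : conjFr hF₁ ι.hom hA hB hAB ≫ conjFr hF₁ ι.inv hB hA hBA = 𝟙 _ := by
    rw [← conjFr_comp, ι.hom_inv_id, conjFr_id]
  have h₂ : conjFr hF₁ ι.inv hB hA hBA ≫ conjFr hF₁ ι.hom hA hB hAB = 𝟙 _ := by
    rw [← conjFr_comp, ι.inv_hom_id, conjFr_id]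
  let r : Rep (⟨A, n⟩ : Perfection hF₁) ⟨B, n⟩ := ⟨⟨1, 1, rfl⟩, conjFr hF₁ ι.hom hA hB hAB⟩
  haveI : IsIso (X := (⟨A, n⟩ : Perfection hF₁)) (Y := ⟨B, n⟩) (Hom.mk r) :=
    isIso_mk_of_isIso r ⟨⟨conjFr hF₁ ι.inv hB hA hBA, h₁, h₂⟩⟩
  exact ⟨asIso (Hom.mk r : (⟨A, n⟩ : Perfection hF₁) ⟶ ⟨B, n⟩)⟩

/-! ### `Ψ^pf` is an equivalence when `Ψ` is -/

section Equivalence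

variable (Ψ : C₁ ≌ C₂) (hΨ : IsFrobeniusCompatible F₁ F₂ Ψ.functor)
include hΨ

/-- `Ψ^pf` is faithful (agreement of the images at a level of `(Ψ A, n) → (Ψ B, m)` is agreement at the same
level of `(A, n) → (B, m)`, as `Ψ` is faithful). [cite: MochizukiFrdI2008, Thm. 3.4 (iii) p.62] -/
theorem map_faithful : (map (hF₁ := hF₁) (hF₂ := hF₂) hΨ).Faithful := by
  refine ⟨fun {X Y} f g h => ?_⟩
  obtain ⟨r, rfl⟩ := Hom.mk_surjective f
  obtain ⟨s, rfl⟩ := Hom.mk_surjective g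
  rw [map_mk, map_mk] at h
  obtain ⟨M, hr, hs, e⟩ := Hom.mk_eq_mk.mp h
  let M₁ : Level X Y := ⟨M.a, M.b, M.eq⟩
  have er : (repMap (hF₁ := hF₁) (hF₂ := hF₂) hΨ ⟨M₁, Level.lift r.L M₁ hr r.hom⟩).hom =
      Level.lift (levelMap Ψ.functor r.L) (levelMap Ψ.functor M₁) (levelMap_le Ψ.functor hr)
        (repMap (hF₁ := hF₁) (hF₂ := hF₂) hΨ r).hom :=
    repMap_lift hΨ r.L M₁ hr r.hom
  have es : (repMap (hF₁ := hF₁) (hF₂ := hF₂) hΨ ⟨M₁, Level.lift s.L M₁ hs s.hom⟩).hom =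
      Level.lift (levelMap Ψ.functor s.L) (levelMap Ψ.functor M₁) (levelMap_le Ψ.functor hs)
        (repMap (hF₁ := hF₁) (hF₂ := hF₂) hΨ s).hom :=
    repMap_lift hΨ s.L M₁ hs s.hom
  change Level.lift (levelMap Ψ.functor r.L) (levelMap Ψ.functor M₁) (levelMap_le Ψ.functor hr) (repMap hΨ r).hom =
    Level.lift (levelMap Ψ.functor s.L) (levelMap Ψ.functor M₁) (levelMap_le Ψ.functor hs) (repMap hΨ s).hom at e
  rw [← er, ← es, repMap_hom, repMap_hom, cancel_epi, cancel_mono] at e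
  exact Hom.mk_eq_mk.mpr ⟨M₁, hr, hs, Ψ.functor.map_injective e⟩

/-- `Ψ^pf` is full (a representative `(Ψ A)^{(a)} → (Ψ B)^{(b)}` is, after the comparison isomorphisms, the image
of an arrow `A^{(a)} → B^{(b)}`, as `Ψ` is full). [cite: MochizukiFrdI2008, Thm. 3.4 (iii) p.62] -/
theorem map_full : (map (hF₁ := hF₁) (hF₂ := hF₂) hΨ).Full := by
  refine ⟨fun {X Y} f => ?_⟩
  revert f
  change ∀ f : objMap (hF₂ := hF₂) Ψ.functor X ⟶ objMap (hF₂ := hF₂) Ψ.functor Y,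
    ∃ g : X ⟶ Y, homMap hΨ g = f
  intro f
  obtain ⟨⟨L, θ⟩, rfl⟩ := Hom.mk_surjective f
  let L₁ : Level X Y := ⟨L.a, L.b, L.eq⟩
  let θ₁ : L₁.HomAt :=
    Ψ.functor.preimage ((frobPowIso hΨ X.obj L.a).hom ≫ θ ≫ (frobPowIso hΨ Y.obj L.b).inv)
  refine ⟨Hom.mk ⟨L₁, θ₁⟩, ?_⟩
  rw [homMap_mk]
  change Hom.mk ⟨L, (frobPowIso hΨ X.obj L.a).inv ≫ Ψ.functor.map θ₁ ≫ (frobPowIso hΨ Y.obj L.b).hom⟩ =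
    Hom.mk ⟨L, θ⟩
  rw [Ψ.functor.map_preimage]
  simp only [Category.assoc, Iso.inv_hom_id, Category.comp_id, Iso.inv_hom_id_assoc]

/-- `Ψ^pf` is essentially surjective: `(B, n) ≅ (Ψ Ψ⁻¹ B, n) = Ψ^pf (Ψ⁻¹ B, n)`.
[cite: MochizukiFrdI2008, Thm. 3.4 (iii) p.62] -/
theorem map_essSurj : (map (hF₁ := hF₁) (hF₂ := hF₂) hΨ).EssSurj := by
  refine ⟨fun Y => ?_⟩
  obtain ⟨B, n⟩ := Y
  obtain ⟨i⟩ := nonempty_rootIso (hF₁ := hF₂) (Ψ.counitIso.app B) n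
  exact ⟨⟨Ψ.inverse.obj B, n⟩, ⟨i⟩⟩

/-- **`Ψ^pf` is an equivalence of categories** for an equivalence `Ψ` compatible with arrows of Frobenius
type (the "horizontal arrows are equivalences" clause of Thm. 3.4 (iii) for the perfection square).
[cite: MochizukiFrdI2008, Thm. 3.4 (iii) p.62] -/
theorem map_isEquivalence : (map (hF₁ := hF₁) (hF₂ := hF₂) hΨ).IsEquivalence :=
  haveI := map_faithful (hF₁ := hF₁) (hF₂ := hF₂) Ψ hΨ
  haveI := map_full (hF₁ := hF₁) (hF₂ := hF₂) Ψ hΨ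
  haveI := map_essSurj (hF₁ := hF₁) (hF₂ := hF₂) Ψ hΨ
  { }

end Equivalence

end Perfection

end PreFrobenioid

end Literature.AlgebraicGeometry.Frobenioids
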